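import Summits.ResolutionOfSingularities.ResolutionOfSingularities.Theses.EquisingularLift
import Summits.ResolutionOfSingularities.ResolutionOfSingularities.Theorems.WeightedInvariantWeightedThesisProjectiveIntegralSuffices
import Summits.ResolutionOfSingularities.ResolutionOfSingularities.Theorems.WeightedInvariantWeightedThesisFiniteBirationalTransfer
import Summits.ResolutionOfSingularities.ResolutionOfSingularities.Theorems.WeightedInvariantWeightedThesisHypersurfaceModelInfinite
import HarnessLib

/-!
# `EquisingularLift.HypersurfacesSuffice` (crux stmt-ResolutionOfSingularities-15964), line
# `generic-projection-closure`: hypersurfaces of `ℙᵐ_k` suffice, `k` algebraically closed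

Crux (shared verbatim by routes `EquisingularLift` and `TeissierJung`): over an algebraically closed
field `k` of any characteristic, if every integral closed `H ⊆ ℙᵐ_k` with locally principal ideal
sheaf (a hypersurface) has a resolution of singularities, then every reduced separated `k`-scheme of
finite type has one.

Skeleton (lead, cycle 1). The classical proof, assembled from the tree:

* projective reduction `ProjectiveIntegralSuffices.stub_projectiveIntegralSuffices` (irreducible
  components, Chow, projective closure; PROVED, p86611) reduces to integral closed `Z ⊆ ℙⁿ_k`;
* generic linear forms `t₀, …, t_{d+1}` (`d = dim Z`) with `K(Z) = k(t_a/t₀)` exist over the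
  infinite perfect field `k` (`stub_exists_linearForms` — the content of the landed
  `HypersurfaceModel.hypersurfaceModel_infinite_of_stubs`, re-concluded one step earlier);
* the linear projection `π_t : Z → ℙ^{d+1}` is finite, misses the vertex and is surjective on the
  stalk at the generic point (tree, `HypersurfaceModel.hypersurfaceModel_of_linearForms`, Part D);
* NEW GLUE: its scheme-theoretic image `H ⊆ ℙ^{d+1}` — CLOSED in `ℙ^{d+1}` itself, not only in the
  punctured space — is integral with locally principal ideal: off the vertex by the landed chart
  computation `HypersurfaceModel.exists_ker_ideal_isPrincipal` transported along the open immersion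
  `ℙ^{d+1} ∖ {vertex} ↪ ℙ^{d+1}` (`stub_ker_isPrincipal_of_ne_vertex`), and near the vertex because
  the (closed) image misses it, so the kernel is the unit ideal on a small affine neighbourhood
  (`stub_ker_isPrincipal_vertex`); `Z → H` is finite birational (`stub_toImage_finite_birational`);
* finite birational transfer `FiniteBirationalTransfer.stub_finiteBirationalTransfer` (PROVED,
  p98340) pulls the assumed resolution of `H` back to `Z`.

Spelling: the geometric statements are written for `ℙ^m_k = ProjCech.PP k m = Proj k[x₀,…,x_m]`,
to which `(Motives.projectiveSpace m k).left` reduces by `rfl` (but not reducibly, so instances are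
passed explicitly at the two junctions with the `projectiveSpace` spelling).

[Hartshorne 1977, I Prop. 4.9; Kollár 2007, proof of Prop. 2.48; Cossart–Piltant 2019, Prop. 4.6]
-/

noncomputable section

set_option linter.dupNamespace false -- mandated namespace of this single-conjunct summit

open CategoryTheory CategoryTheory.Limits AlgebraicGeometry TopologicalSpace Topology
  HomogeneousLocalization
open Literature.AlgebraicGeometry.Resolution Literature.AlgebraicGeometry.Motives
open Literature.AlgebraicGeometry.Motives.Segre (grading cst frac chartι toSpec X_mem pull pull_comp
  pull_SpecMap')
open Literature.AlgebraicGeometry.Morphisms.ProjCech (PP)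
open Summit.ResolutionOfSingularities.ResolutionOfSingularities.Theorems.WeightedThesis

attribute [local instance] MvPolynomial.gradedAlgebra

namespace Summit.ResolutionOfSingularities.ResolutionOfSingularities.Theorems.HypersurfacesSuffice

/-! ## Stubs -/

/-- **S1 — generic linear forms.** For an integral closed `X ⊆ ℙⁿ_k` over an infinite perfect
field `k` there are `d = dim X` and linear forms `t₀, …, t_{d+1}` with `t₀, …, t_d` without common
zero on `X`, `t₀ ≢ 0` on `X`, and `K(X) = k(t₁/t₀, …, t_{d+1}/t₀)` (separating transcendence basis
from `dim Ω[K(X)⁄k] = d` plus a primitive element, all generic).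
[cite: Kollar2007, Prop. 2.48 (proof); Hartshorne1977, I Prop. 4.9] -/
theorem stub_exists_linearForms : ∀ (k : Type) [Field k] [PerfectField k] [Infinite k] (n : ℕ) (X : AlgebraicGeometry.Scheme.{0}) (ι : X ⟶ (Literature.AlgebraicGeometry.Motives.projectiveSpace n k).left) [AlgebraicGeometry.IsClosedImmersion ι] [AlgebraicGeometry.IsIntegral X], ∃ (d : ℕ) (t : Fin (d + 1 + 1) → Fin (n + 1) → k), Literature.AlgebraicGeometry.Resolution.LinSec.NoCommonZero ι (Literature.AlgebraicGeometry.Resolution.LinSec.tInit t) ∧ Literature.AlgebraicGeometry.Resolution.LinSec.formFn ι (t 0) ≠ 0 ∧ topologicalKrullDim X = d ∧ Subfield.closure (Set.range ((X.presheaf.germ ⊤ (genericPoint X) trivial).hom.comp ((ι ≫ (Literature.AlgebraicGeometry.Motives.projectiveSpace n k).hom).appTop.hom.comp (AlgebraicGeometry.Scheme.ΓSpecIso (.of k)).inv.hom)) ∪ Set.range (fun a : Fin (d + 1) => Literature.AlgebraicGeometry.Resolution.LinSec.formFn ι (t a.succ) / Literature.AlgebraicGeometry.Resolution.LinSec.formFn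 ι (t 0))) = ⊤ := by
  sorry

/-- **S2 — the image ideal is locally principal off the vertex.** For `X` integral of dimension
`d` and `φ₀ : X → ℙ^{d+1}_k` finite avoiding the vertex, every point `y ≠ vertex` of `ℙ^{d+1}` has
an affine neighbourhood on which the kernel of `φ₀^*` is principal (a chart `D₊(x_i)`, `i ≤ d`, of
the punctured space, where it is generated by a minimal polynomial).
[cite: Hartshorne1977, I Prop. 4.9 (proof)] -/
theorem stub_ker_isPrincipal_of_ne_vertex : ∀ (d : ℕ) (k : Type) [Field k] (X : AlgebraicGeometry.Scheme.{0}) [AlgebraicGeometry.IsIntegral X] (φ₀ : X ⟶ Literature.AlgebraicGeometry.Morphisms.ProjCech.PP k (d + 1)) [AlgebraicGeometry.IsFinite φ₀], (∀ x : X, φ₀ x ≠ Literature.AlgebraicGeometry.Resolution.DeJong1996.vertex d k) → topologicalKrullDim X = d → ∀ y : Literature.AlgebraicGeometry.Morphisms.ProjCech.PP k (d + 1), y ≠ Literature.AlgebraicGeometry.Resolution.DeJong1996.vertex d k → ∃ U : (Literature.AlgebraicGeometry.Morphisms.ProjCech.PP k (d + 1)).affineOpens, y ∈ (U : (Literature.AlgebraicGeometry.Morphisms.ProjCech.PP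 k (d + 1)).Opens) ∧ (φ₀.ker.ideal U).IsPrincipal := by
  sorry

/-- **S3 — the image ideal is trivial near the vertex.** For `φ₀ : X → ℙ^{d+1}_k` finite (hence
closed) avoiding the vertex, the vertex has an affine neighbourhood disjoint from the image, on
which the kernel of `φ₀^*` is the unit ideal, in particular principal. [folklore] -/
theorem stub_ker_isPrincipal_vertex : ∀ (d : ℕ) (k : Type) [Field k] (X : AlgebraicGeometry.Scheme.{0}) (φ₀ : X ⟶ Literature.AlgebraicGeometry.Morphisms.ProjCech.PP k (d + 1)) [AlgebraicGeometry.IsFinite φ₀], (∀ x : X, φ₀ x ≠ Literature.AlgebraicGeometry.Resolution.DeJong1996.vertex d k) → ∃ U : (Literature.AlgebraicGeometry.Morphisms.ProjCech.PP k (d + 1)).affineOpens, Literature.AlgebraicGeometry.Resolution.DeJong1996.vertex d k ∈ (U : (Literature.AlgebraicGeometry.Morphisms.ProjCech.PP k (d + 1)).Opens) ∧ (φ₀.ker.ideal U).IsPrincipal := by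
  sorry

/-- **S4 — the map onto the scheme-theoretic image is finite birational.** For `X` integral and
`φ₀ : X → ℙ^{d+1}_k` finite whose stalk map at the generic point is surjective, the
scheme-theoretic image `H = φ₀.image` is integral and `φ₀.toImage : X → H` is finite and
birational. [folklore; cite: StacksProject, Tag 0AB1] -/
theorem stub_toImage_finite_birational : ∀ (d : ℕ) (k : Type) [Field k] (X : AlgebraicGeometry.Scheme.{0}) [AlgebraicGeometry.IsIntegral X] (φ₀ : X ⟶ Literature.AlgebraicGeometry.Morphisms.ProjCech.PP k (d + 1)) [AlgebraicGeometry.IsFinite φ₀], Function.Surjective (φ₀.stalkMap (genericPoint X)) → AlgebraicGeometry.IsIntegral φ₀.image ∧ AlgebraicGeometry.IsFinite φ₀.toImage ∧ Literature.AlgebraicGeometry.Resolution.IsBirational φ₀.toImage := by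
  sorry

/-! ## Glue: projective hypersurface models -/

/-- **Projective hypersurface models from a finite projection.** `X` integral of dimension `d`,
`φ₀ : X → ℙ^{d+1}_k` finite, avoiding the vertex, surjective on the stalk at the generic point ⇒
the scheme-theoretic image `H ⊆ ℙ^{d+1}` is an integral closed subscheme with locally principal
ideal and `X → H` is finite birational. [cite: Hartshorne1977, I Prop. 4.9] -/
theorem projectiveModel_of_projection (d : ℕ) (k : Type) [Field k] (X : Scheme.{0}) [IsIntegral X]
    (φ₀ : X ⟶ PP k (d + 1)) [IsFinite φ₀]
    (hv : ∀ x : X, φ₀ x ≠ DeJong1996.vertex d k) (hdim : topologicalKrullDim X = d)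
    (hgen : Function.Surjective (φ₀.stalkMap (genericPoint X))) :
    ∃ (H : Scheme.{0}) (j : H ⟶ PP k (d + 1)) (φ : X ⟶ H),
      IsClosedImmersion j ∧ IsIntegral H ∧
      (∀ y : PP k (d + 1), ∃ U : (PP k (d + 1)).affineOpens,
        y ∈ (U : (PP k (d + 1)).Opens) ∧ (j.ker.ideal U).IsPrincipal) ∧
      IsFinite φ ∧ IsBirational φ := by
  obtain ⟨hint, hfin, hbir⟩ := stub_toImage_finite_birational d k X φ₀ hgen
  refine ⟨φ₀.image, φ₀.imageι, φ₀.toImage, inferInstance, hint, fun y => ?_, hfin, hbir⟩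
  rw [Scheme.IdealSheafData.ker_subschemeι]
  by_cases hy : y = DeJong1996.vertex d k
  · subst hy
    exact stub_ker_isPrincipal_vertex d k X φ₀ hv
  · exact stub_ker_isPrincipal_of_ne_vertex d k X φ₀ hv hdim y hy

/-- **Projective hypersurface models from linear forms generating the function field** (the tree's
`HypersurfaceModel.hypersurfaceModel_of_linearForms`, re-concluded in `ℙ^{d+1}`): for an integral
closed `X ⊆ ℙⁿ_k` of dimension `d` and linear forms `t₀, …, t_{d+1}` with `t₀, …, t_d` without
common zero on `X`, `t₀ ≢ 0` on `X` and `K(X) = k(t_a/t₀)`, the linear projection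
`π_t : X → ℙ^{d+1}` is finite, avoids the vertex and is surjective on the stalk at the generic
point, so `projectiveModel_of_projection` applies.
[cite: Hartshorne1977, I Prop. 4.9; Kollar2007, Prop. 2.48 (proof)] -/
theorem projectiveModel_of_linearForms (k : Type) [Field k] (n : ℕ) {X : Scheme.{0}} [IsIntegral X]
    (ι : X ⟶ PP k n) [IsClosedImmersion ι] (d : ℕ) (t : Fin (d + 1 + 1) → Fin (n + 1) → k)
    (hbpf : LinSec.NoCommonZero ι (LinSec.tInit t)) (ht0 : LinSec.formFn ι (t 0) ≠ 0)
    (hdim : topologicalKrullDim X = d)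
    (hgen : Subfield.closure
        (Set.range ((X.presheaf.germ ⊤ (genericPoint X) trivial).hom.comp
            ((ι ≫ toSpec (Fin (n + 1)) k).appTop.hom.comp (Scheme.ΓSpecIso (.of k)).inv.hom)) ∪
          Set.range (fun a : Fin (d + 1) => LinSec.formFn ι (t a.succ) / LinSec.formFn ι (t 0))) = ⊤) :
    ∃ (H : Scheme.{0}) (j : H ⟶ PP k (d + 1)) (φ : X ⟶ H),
      IsClosedImmersion j ∧ IsIntegral H ∧
      (∀ y : PP k (d + 1), ∃ U : (PP k (d + 1)).affineOpens,
        y ∈ (U : (PP k (d + 1)).Opens) ∧ (j.ker.ideal U).IsPrincipal) ∧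
      IsFinite φ ∧ IsBirational φ := by
  -- adapted from Theorems/WeightedInvariantWeightedThesisHypersurfaceModelProjection.lean, Part D
  obtain ⟨-, -, hpr⟩ := HypersurfaceModel.smooth_isSeparated_isProper_toSpec k n
  haveI := hpr
  set f : X ⟶ Spec (.of k) := ι ≫ toSpec (Fin (n + 1)) k with hf
  haveI : IsProper f := inferInstance
  have hbpf' : LinSec.NoCommonZero ι t :=
    ⟨fun x => let ⟨i, hi⟩ := hbpf.exists_notMem x; ⟨Fin.castSucc i, hi⟩⟩
  set φ₀ := LinSec.proj ι t f hbpf' with hφ₀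
  haveI : IsFinite φ₀ := LinSec.isFinite_proj ι t f hbpf'
  have hv : ∀ x : X, φ₀ x ≠ DeJong1996.vertex d k := fun x hx => by
    rw [hφ₀, LinSec.proj_eq_vertex_iff] at hx
    obtain ⟨i, hi⟩ := hbpf.exists_notMem x
    exact hi (Set.mem_iInter.1 hx i)
  refine projectiveModel_of_projection d k X φ₀ hv hdim ?_
  -- the image of the stalk map at the generic point is a subfield containing the generators
  set F := (φ₀.stalkMap (genericPoint X)).hom with hF
  let S : Subfield X.functionField :=
    { F.range with
      inv_mem' := fun r hr => HypersurfaceModel.inv_mem_range_stalkMap φ₀ hr }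
  have hS : (⊤ : Subfield X.functionField) ≤ S := by
    rw [← hgen, Subfield.closure_le]
    rintro r (⟨c, rfl⟩ | ⟨a, rfl⟩)
    · -- constants
      refine ⟨((PP k (d + 1)).presheaf.germ ⊤ (φ₀ (genericPoint X)) trivial).hom
        ((toSpec (Fin (d + 1 + 1)) k).appTop ((Scheme.ΓSpecIso (.of k)).inv c)), ?_⟩
      exact HypersurfaceModel.stalkMap_germ_const k φ₀ (toSpec (Fin (d + 1 + 1)) k) f
        (LinSec.proj_toSpec ι t f hbpf') _ c
    · -- the ratios `t_a / t_0`
      have h0 : LinSec.formVec ι t 0 ≠ 0 := ht0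
      have hxU : genericPoint X ∈ lsChart (LinSec.formVec ι t) 0 := genericPoint_mem_lsChart _ h0
      have hη0 : genericPoint X ∉ LinSec.hyp ι (t 0) := by
        rw [← LinSec.isUnitAt_formFn_div_iff ι (LinSec.genericPoint_mem_chart_j₀ ι)]
        exact RatFn.isUnitAt_genericPoint (div_ne_zero ht0
          (LinSec.formFn_single_ne_zero ι (LinSec.genericPoint_mem_chart_j₀ ι)))
      have hxP : φ₀ (genericPoint X) ∈ (ProjSpace.U 0 : (ProjSpace.P (d + 1) k).Opens) :=
        (LinSec.proj_apply_mem_basicOpen_iff ι t f hbpf' _ 0).2 hη0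
      refine ⟨((ProjSpace.P (d + 1) k).presheaf.germ (ProjSpace.U 0) _ hxP).hom
        (ProjSpace.sec 0 (Segre.frac k 0 a.succ)), ?_⟩
      exact (LinSec.stalkMap_proj_germ_sec ι t f hbpf' 0 hxP hxU a.succ).trans
        (ofSection_lsRatio (LinSec.formVec ι t) h0 a.succ)
  intro r
  obtain ⟨a, ha⟩ := hS (Subfield.mem_top r)
  exact ⟨a, ha⟩

/-- **Projective hypersurface models over infinite perfect fields** (`projectiveSpace` spelling).
Every integral closed `X ⊆ ℙⁿ_k`, `k` infinite perfect, admits a finite birational morphism onto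
an integral closed `H ⊆ ℙᵐ_k` (`m = dim X + 1`) whose ideal sheaf is locally principal: the image
of the generic linear projection. [cite: Hartshorne1977, I Prop. 4.9; Kollar2007, Prop. 2.48 (proof)] -/
theorem projectiveModel (k : Type) [Field k] [PerfectField k] [Infinite k] (n : ℕ) (X : Scheme.{0})
    (ι : X ⟶ (projectiveSpace n k).left) [hι : IsClosedImmersion ι] [IsIntegral X] :
    ∃ (m : ℕ) (H : Scheme.{0}) (j : H ⟶ (projectiveSpace m k).left) (φ : X ⟶ H),
      IsClosedImmersion j ∧ IsIntegral H ∧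
      (∀ y : (projectiveSpace m k).left, ∃ U : (projectiveSpace m k).left.affineOpens,
        y ∈ (U : (projectiveSpace m k).left.Opens) ∧ (j.ker.ideal U).IsPrincipal) ∧
      IsFinite φ ∧ IsBirational φ := by
  obtain ⟨d, t, hbpf, ht0, hdim, hgen⟩ := stub_exists_linearForms k n X ι
  exact ⟨d + 1, @projectiveModel_of_linearForms k _ n X _ ι hι d t hbpf ht0 hdim hgen⟩

/-! ## The crux -/

/-- **Hypersurfaces suffice** (crux `HypersurfacesSuffice`, shared by routes `EquisingularLift` and
`TeissierJung`): over an algebraically closed field `k` (any characteristic), if every integral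
closed `H ⊆ ℙᵐ_k` with locally principal ideal sheaf has a resolution of singularities, then every
reduced separated `k`-scheme of finite type has one. Projective reduction
(`stub_projectiveIntegralSuffices`), projective hypersurface model by generic linear projection
(`projectiveModel`; `k` is infinite and perfect), finite birational transfer
(`stub_finiteBirationalTransfer`).
[cite: Hartshorne1977, I Prop. 4.9; Kollar2007, Prop. 2.48 (proof); CossartPiltant2019, Prop. 4.6 (proof, Steps 1–3)] -/
theorem HypersurfacesSuffice_of :
    Summit.ResolutionOfSingularities.ResolutionOfSingularities.Theses.EquisingularLift.HypersurfacesSuffice := by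
  intro k _ _ hH X f hsep hlft hqc hred
  haveI : PerfectField k := IsAlgClosed.perfectField k
  refine ProjectiveIntegralSuffices.stub_projectiveIntegralSuffices k (fun n Z ι hι hint => ?_)
    X f hsep hlft hqc hred
  haveI := hι
  haveI := hint
  obtain ⟨m, H, j, φ, hj, hH', hprinc, hφ, hbir⟩ := projectiveModel k n Z ι
  haveI := hH'
  exact FiniteBirationalTransfer.stub_finiteBirationalTransfer Z H φ hφ hbir (hH m H j hj hH' hprinc)

end Summit.ResolutionOfSingularities.ResolutionOfSingularities.Theorems.HypersurfacesSuffice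

end
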